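import Summits.ResolutionOfSingularities.ResolutionOfSingularities.Theorems.FrobeniusLadderFInjectiveMacaulayficationWildPinchClosedCentre
import Summits.ResolutionOfSingularities.ResolutionOfSingularities.Theorems.RadicialJungCleanModelsSufficeGameEndStrata
import HarnessLib

/-!
# FC″ at the motivating wild example: the body of `FCUnguarded` for (a surface with a FULL line blow-up) × 𝔸¹ — e.g. the wild pinch × 𝔸¹
# (crux `FInjectiveMacaulayfication` stmt-ResolutionOfSingularities-15315, chain w45a, door v30 = DM ∧ #4β ∧ FC″)

[OURS · L1 W4.5a · res-L1-w45a-lead-1 gen 5] Support file (`--supports stmt-ResolutionOfSingularities-15315 --as helper`); NOT a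
statement of any manuscript; AI-written, weaker than expert review.

Door v30's non-closed stub is FC″ = `GenericFibreReduction.FCUnguarded` (p543297): at a bad non-closed `η` there are an ideal sheaf
`J ∋ η` and a LocFix datum `c'` at `η` in currency (A′) — `(c') ≠ 0`, `(c') ≤ 𝔪_η`, the affine blow-up charts of `(c')` FULL over `𝔪_η`,
`J_η = (c')` — every blowing up along `J` being FULL at the non-closed points over `supp J` and CM at the closed ones. Its docstring names
the motivating example for dropping the ∀c-guard of FC′: the WILD PINCH × 𝔸¹, where `η` (the generic point of `{wild point} × 𝔸¹`) has
NO `𝔪_η`-primary point-fix (Theorem W), but the ideal of the wild curve through `η` qualifies as `c'`.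

This file produces that witness, by the cylinder pattern of res-L1-w45a-stub-3's `FCForallExistsCylinder.cylinder_witness` with the
point-fix replaced by ANY ideal `I = (g₁,…,gₙ) ⊆ R` whose blowing up `Bl_I Spec R` is FULL at every stalk:
* `cylinder_witness_of_full` — for every prime `𝔭 ⊇ I` and `η = 𝔭R[t]`: `J := (I·R[t])~ ≠ ⊥`, `η ∈ supp J`, `c' :=` the image of `g`
  in `𝒪_η`, `(c') ≠ 0`, `(c') ≤ 𝔪_η`, charts FULL over `𝔪_η` (reverse dictionary `IsBlowup.exists_point_of_blowupAlgebra_prime`),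
  `J_η = (c')`, and EVERY blowing up along `J` FULL EVERYWHERE (`fiClause_of_isBlowup_cylinder`);
* `fcUnguarded_body_cylinder_of_full` — the conjuncts of `FCUnguarded`'s conclusion, verbatim shape;
* `fcUnguarded_body_wildPinchCylinder` — the wild pinch × 𝔸¹ (`char k = 2`, `I = (ȳ, t̄)`, `WildPinchClosedCentre.affineBlowup_full`):
  the FIRST inhabited instance of the FC″ body at a WILD non-closed point.
[folklore assembly; cite: StacksProject, Tag 0805]
-/

-- single-problem summit: the doubled namespace component is forced
set_option linter.dupNamespace false

noncomputable section

universe u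

open Polynomial AlgebraicGeometry CategoryTheory Literature.AlgebraicGeometry.Resolution TopologicalSpace IsLocalRing

namespace Summit.ResolutionOfSingularities.ResolutionOfSingularities.Theorems.FInjectiveMacaulayfication.FullBlowupCylinderFC

open Summit.ResolutionOfSingularities.ResolutionOfSingularities.Theorems.FInjectiveMacaulayfication
open Summit.ResolutionOfSingularities.ResolutionOfSingularities.Theorems.FInjectiveMacaulayfication.FCForallExistsCylinder

/-! ## §1 The cylinder witness from a FULL blowing up -/

/-- **THE CYLINDER WITNESS FROM A FULL BLOW-UP.** `R` a Noetherian domain of characteristic `p`, `I = (g₁,…,gₙ) ≠ 0` an ideal whose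
blowing up `Bl_I Spec R` is FULL at every stalk, `𝔭 ⊇ I` a prime, `η = 𝔭·R[t] ∈ Spec R[t]`. Then for `J := (I·R[t])~` and `c' :=` the
image of `g` in `𝒪_η`: `J ≠ ⊥`, `η ∈ supp J`, `(c') ≠ 0`, `(c') ≤ 𝔪_η`, every chart of `Bl_{(c')} Spec 𝒪_η` over `𝔪_η` is FULL,
`J_η = (c')`, and EVERY blowing up of `Spec R[t]` along `J` is FULL AT EVERY STALK. (`FCForallExistsCylinder.cylinder_witness` with the
`𝔪`-primary point-fix replaced by an arbitrary FULL centre.) [cite: StacksProject, Tag 0804, Tag 0805] -/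
theorem cylinder_witness_of_full (p : ℕ) [Fact p.Prime] (R : Type) [CommRing R] [IsDomain R] [IsNoetherianRing R] [CharP R p]
    {n : ℕ} (g : Fin n → R) (I : Ideal R) (hIg : I = Ideal.span (Set.range g)) (hI0 : I ≠ ⊥)
    (hBl : ∀ y : ↥(affineBlowup I), IsDomain ((affineBlowup I).presheaf.stalk y) ∧
      ∀ d : ℕ, ringKrullDim ((affineBlowup I).presheaf.stalk y) = d →
        ∀ s : Fin d → (affineBlowup I).presheaf.stalk y, (Ideal.span (Set.range s)).radical.IsMaximal →
          RingTheory.Sequence.IsWeaklyRegular ((affineBlowup I).presheaf.stalk y) (List.ofFn s) ∧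
          ∀ z : (affineBlowup I).presheaf.stalk y, (∃ e : ℕ, z ^ p ^ e ∈
              Ideal.span ((fun w : (affineBlowup I).presheaf.stalk y => w ^ p ^ e) ''
                (Ideal.span (Set.range s) : Set ((affineBlowup I).presheaf.stalk y)))) →
            z ∈ Ideal.span (Set.range s))
    (𝔭 : Spec (.of R)) (h𝔭 : I ≤ 𝔭.asIdeal)
    (η : Spec (.of R[X])) (hη : η.asIdeal = 𝔭.asIdeal.map (C : R →+* R[X])) :
    ∃ (J : (Spec (.of R[X])).IdealSheafData) (n' : ℕ) (c' : Fin n' → (Spec (.of R[X])).presheaf.stalk η),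
      J ≠ ⊥ ∧ η ∈ (J.support : Set (Spec (.of R[X]))) ∧
      Ideal.span (Set.range c') ≠ ⊥ ∧ Ideal.span (Set.range c') ≤ maximalIdeal ((Spec (.of R[X])).presheaf.stalk η) ∧
      (∀ (j : Fin n') (𝔔 : PrimeSpectrum (blowupAlgebra (Ideal.span (Set.range c')) (c' j))),
        𝔔.asIdeal.comap (algebraMap ((Spec (.of R[X])).presheaf.stalk η) (blowupAlgebra (Ideal.span (Set.range c')) (c' j))) =
          maximalIdeal ((Spec (.of R[X])).presheaf.stalk η) →
        IsDomain (Localization.AtPrime 𝔔.asIdeal) ∧ ∀ d : ℕ, ringKrullDim (Localization.AtPrime 𝔔.asIdeal) = d →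
          ∀ s : Fin d → Localization.AtPrime 𝔔.asIdeal, (Ideal.span (Set.range s)).radical.IsMaximal →
            RingTheory.Sequence.IsWeaklyRegular (Localization.AtPrime 𝔔.asIdeal) (List.ofFn s) ∧
            ∀ y : Localization.AtPrime 𝔔.asIdeal, (∃ e : ℕ, y ^ p ^ e ∈ Ideal.span ((fun z : Localization.AtPrime 𝔔.asIdeal => z ^ p ^ e) ''
              (Ideal.span (Set.range s) : Set (Localization.AtPrime 𝔔.asIdeal)))) → y ∈ Ideal.span (Set.range s)) ∧
      stalkIdeal J η = Ideal.span (Set.range c') ∧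
      ∀ (X₂ : Scheme.{0}) (π : X₂ ⟶ Spec (.of R[X])), IsBlowup π J →
        ∀ x : X₂, IsDomain (X₂.presheaf.stalk x) ∧ ∀ d : ℕ, ringKrullDim (X₂.presheaf.stalk x) = d → ∀ s : Fin d → X₂.presheaf.stalk x,
          (Ideal.span (Set.range s)).radical.IsMaximal → RingTheory.Sequence.IsWeaklyRegular (X₂.presheaf.stalk x) (List.ofFn s) ∧
          ∀ t : X₂.presheaf.stalk x, (∃ e : ℕ, t ^ p ^ e ∈ Ideal.span ((fun z : X₂.presheaf.stalk x => z ^ p ^ e) ''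
            (Ideal.span (Set.range s) : Set (X₂.presheaf.stalk x)))) → t ∈ Ideal.span (Set.range s) := by
  letI algX : Algebra R[X] ((Spec (.of R[X])).presheaf.stalk η) :=
    inferInstanceAs (Algebra R[X] ((Spec.structureSheaf R[X]).presheaf.stalk η))
  haveI : IsLocalization.AtPrime ((Spec (.of R[X])).presheaf.stalk η) η.asIdeal :=
    inferInstanceAs (IsLocalization.AtPrime ((Spec.structureSheaf R[X]).presheaf.stalk η) η.asIdeal)
  -- §2 of the cylinder file: every blowing up of `Spec R[t]` along `J = (I·R[t])~` is FULL at every stalk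
  have hfull := fiClause_of_isBlowup_cylinder p R I hBl
  -- the witness `c'`: the image of the generators `g` in `𝒪_η`
  let c' : Fin n → (Spec (.of R[X])).presheaf.stalk η := fun j => algebraMap R[X] ((Spec (.of R[X])).presheaf.stalk η) (C (g j))
  have hspan : Ideal.span (Set.range c') = (I.map (C : R →+* R[X])).map (algebraMap R[X] ((Spec (.of R[X])).presheaf.stalk η)) := by
    rw [hIg, Ideal.map_span, Ideal.map_span, ← Set.range_comp, ← Set.range_comp]
    rfl
  -- `J_η = I·𝒪_η = (c')`
  have h1 : stalkIdeal (affineBlowup.idealSheaf (I.map (C : R →+* R[X]))) η =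
      (I.map (C : R →+* R[X])).map (algebraMap R[X] ((Spec (.of R[X])).presheaf.stalk η)) :=
    stalkIdeal_idealSheaf _ _
  have hJη : stalkIdeal (affineBlowup.idealSheaf (I.map (C : R →+* R[X]))) η = Ideal.span (Set.range c') := by
    rw [h1, hspan]
  -- `I R[t] ≤ η`
  have hIη : I.map (C : R →+* R[X]) ≤ η.asIdeal := by
    rw [hη]
    exact Ideal.map_mono h𝔭
  -- `(c') ≤ 𝔪_η`
  have hle : Ideal.span (Set.range c') ≤ maximalIdeal ((Spec (.of R[X])).presheaf.stalk η) := by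
    rw [hspan, ← IsLocalization.AtPrime.map_eq_maximalIdeal η.asIdeal ((Spec (.of R[X])).presheaf.stalk η)]
    exact Ideal.map_mono hIη
  -- `(c') ≠ 0`
  have hne : Ideal.span (Set.range c') ≠ ⊥ := by
    rw [← hJη, h1]
    have hinj : Function.Injective (algebraMap R[X] ((Spec (.of R[X])).presheaf.stalk η)) :=
      IsLocalization.injective _ η.asIdeal.primeCompl_le_nonZeroDivisors
    intro h
    exact hI0 ((Ideal.map_eq_bot_iff_of_injective Polynomial.C_injective).mp ((Ideal.map_eq_bot_iff_of_injective hinj).mp h))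
  -- `η ∈ supp J`, `J ≠ ⊥`
  have hηJ : η ∈ ((affineBlowup.idealSheaf (I.map (C : R →+* R[X]))).support : Set (Spec (.of R[X]))) := by
    rw [mem_support_idealSheaf_iff]
    exact hIη
  have hJ0 : affineBlowup.idealSheaf (I.map (C : R →+* R[X])) ≠ ⊥ :=
    affineBlowup.idealSheaf_ne_bot fun h => hI0 ((Ideal.map_eq_bot_iff_of_injective Polynomial.C_injective).mp h)
  -- the charts of `Bl_{(c')} Spec 𝒪_η` over `𝔪_η` are stalks of `Bl_{I R[t]}` (reverse dictionary), hence FULL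
  have hgood' : ∀ (j : Fin n) (𝔔 : PrimeSpectrum (blowupAlgebra (Ideal.span (Set.range c')) (c' j))),
      𝔔.asIdeal.comap (algebraMap ((Spec (.of R[X])).presheaf.stalk η) (blowupAlgebra (Ideal.span (Set.range c')) (c' j))) =
        maximalIdeal ((Spec (.of R[X])).presheaf.stalk η) →
      IsDomain (Localization.AtPrime 𝔔.asIdeal) ∧ ∀ d : ℕ, ringKrullDim (Localization.AtPrime 𝔔.asIdeal) = d →
        ∀ s : Fin d → Localization.AtPrime 𝔔.asIdeal, (Ideal.span (Set.range s)).radical.IsMaximal →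
          RingTheory.Sequence.IsWeaklyRegular (Localization.AtPrime 𝔔.asIdeal) (List.ofFn s) ∧
          ∀ y : Localization.AtPrime 𝔔.asIdeal, (∃ e : ℕ, y ^ p ^ e ∈ Ideal.span ((fun z : Localization.AtPrime 𝔔.asIdeal => z ^ p ^ e) ''
            (Ideal.span (Set.range s) : Set (Localization.AtPrime 𝔔.asIdeal)))) → y ∈ Ideal.span (Set.range s) := by
    intro j 𝔔 h𝔔
    obtain ⟨x', -, ⟨e⟩⟩ :=
      (affineBlowup.isBlowup (I.map (C : R →+* R[X]))).exists_point_of_blowupAlgebra_prime η c' hJη.symm j 𝔔 h𝔔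
    obtain ⟨hdom, hcl⟩ := hfull _ _ (affineBlowup.isBlowup _) x'
    haveI := hdom
    exact ⟨MulEquiv.isDomain _ e.symm.toMulEquiv,
      DegreeZeroDescent.inlineClause_of_ringEquiv p (L := (affineBlowup (I.map (C : R →+* R[X]))).presheaf.stalk x')
        (L' := Localization.AtPrime 𝔔.asIdeal) e hcl⟩
  exact ⟨affineBlowup.idealSheaf (I.map (C : R →+* R[X])), n, c', hJ0, hηJ, hne, hle, hgood', hJη, hfull⟩

/-- **THE CONJUNCTS OF `FCUnguarded`'S CONCLUSION for `Spec R × 𝔸¹` at `η = 𝔭·R[t]`, from a FULL blowing up `Bl_I Spec R`**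
(`I = (g) ≠ 0`, `I ≤ 𝔭`): `J ≠ ⊥`, `η ∈ supp J`, the LocFix datum `c'` in currency (A′), `J_η = (c')`, every blowing up along `J`
FULL at the non-closed points over `supp J ∖ {η}` (nc) and Cohen–Macaulay at the closed points over `supp J` (cl) — verbatim the
shape of `FCForallExistsCylinder.fcForallExists_body_cylinder` (FC′) and of FC″'s body. [folklore assembly] -/
theorem fcUnguarded_body_cylinder_of_full (p : ℕ) [Fact p.Prime] (R : Type) [CommRing R] [IsDomain R] [IsNoetherianRing R]
    [CharP R p] {n : ℕ} (g : Fin n → R) (I : Ideal R) (hIg : I = Ideal.span (Set.range g)) (hI0 : I ≠ ⊥)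
    (hBl : ∀ y : ↥(affineBlowup I), IsDomain ((affineBlowup I).presheaf.stalk y) ∧
      ∀ d : ℕ, ringKrullDim ((affineBlowup I).presheaf.stalk y) = d →
        ∀ s : Fin d → (affineBlowup I).presheaf.stalk y, (Ideal.span (Set.range s)).radical.IsMaximal →
          RingTheory.Sequence.IsWeaklyRegular ((affineBlowup I).presheaf.stalk y) (List.ofFn s) ∧
          ∀ z : (affineBlowup I).presheaf.stalk y, (∃ e : ℕ, z ^ p ^ e ∈
              Ideal.span ((fun w : (affineBlowup I).presheaf.stalk y => w ^ p ^ e) ''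
                (Ideal.span (Set.range s) : Set ((affineBlowup I).presheaf.stalk y)))) →
            z ∈ Ideal.span (Set.range s))
    (𝔭 : Spec (.of R)) (h𝔭 : I ≤ 𝔭.asIdeal)
    (η : Spec (.of R[X])) (hη : η.asIdeal = 𝔭.asIdeal.map (C : R →+* R[X])) :
    ∃ (J : (Spec (.of R[X])).IdealSheafData) (n' : ℕ) (c' : Fin n' → (Spec (.of R[X])).presheaf.stalk η),
      J ≠ ⊥ ∧ η ∈ (J.support : Set (Spec (.of R[X]))) ∧
      Ideal.span (Set.range c') ≠ ⊥ ∧ Ideal.span (Set.range c') ≤ maximalIdeal ((Spec (.of R[X])).presheaf.stalk η) ∧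
      (∀ (j : Fin n') (𝔔 : PrimeSpectrum (blowupAlgebra (Ideal.span (Set.range c')) (c' j))),
        𝔔.asIdeal.comap (algebraMap ((Spec (.of R[X])).presheaf.stalk η) (blowupAlgebra (Ideal.span (Set.range c')) (c' j))) =
          maximalIdeal ((Spec (.of R[X])).presheaf.stalk η) →
        IsDomain (Localization.AtPrime 𝔔.asIdeal) ∧ ∀ d : ℕ, ringKrullDim (Localization.AtPrime 𝔔.asIdeal) = d →
          ∀ s : Fin d → Localization.AtPrime 𝔔.asIdeal, (Ideal.span (Set.range s)).radical.IsMaximal →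
            RingTheory.Sequence.IsWeaklyRegular (Localization.AtPrime 𝔔.asIdeal) (List.ofFn s) ∧
            ∀ y : Localization.AtPrime 𝔔.asIdeal, (∃ e : ℕ, y ^ p ^ e ∈ Ideal.span ((fun z : Localization.AtPrime 𝔔.asIdeal => z ^ p ^ e) ''
              (Ideal.span (Set.range s) : Set (Localization.AtPrime 𝔔.asIdeal)))) → y ∈ Ideal.span (Set.range s)) ∧
      stalkIdeal J η = Ideal.span (Set.range c') ∧
      (∀ (X₂ : Scheme.{0}) (π : X₂ ⟶ Spec (.of R[X])), IsBlowup π J →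
        (∀ x : X₂, π.base x ∈ (J.support : Set (Spec (.of R[X]))) → π.base x ≠ η → ¬ IsClosed ({x} : Set X₂) →
          IsDomain (X₂.presheaf.stalk x) ∧ ∀ d : ℕ, ringKrullDim (X₂.presheaf.stalk x) = d → ∀ s : Fin d → X₂.presheaf.stalk x,
            (Ideal.span (Set.range s)).radical.IsMaximal → RingTheory.Sequence.IsWeaklyRegular (X₂.presheaf.stalk x) (List.ofFn s) ∧
            ∀ t : X₂.presheaf.stalk x, (∃ e : ℕ, t ^ p ^ e ∈ Ideal.span ((fun z : X₂.presheaf.stalk x => z ^ p ^ e) ''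
              (Ideal.span (Set.range s) : Set (X₂.presheaf.stalk x)))) → t ∈ Ideal.span (Set.range s)) ∧
        (∀ x : X₂, π.base x ∈ (J.support : Set (Spec (.of R[X]))) → IsClosed ({x} : Set X₂) →
          ∀ d : ℕ, ringKrullDim (X₂.presheaf.stalk x) = d → ∀ s : Fin d → X₂.presheaf.stalk x,
            (Ideal.span (Set.range s)).radical.IsMaximal → RingTheory.Sequence.IsWeaklyRegular (X₂.presheaf.stalk x) (List.ofFn s))) := by
  obtain ⟨J, n', c', hJ0, hηJ, hne, hle, hgood', hJη, hfull⟩ := cylinder_witness_of_full p R g I hIg hI0 hBl 𝔭 h𝔭 η hη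
  exact ⟨J, n', c', hJ0, hηJ, hne, hle, hgood', hJη, fun X₂ π hπ =>
    ⟨fun x _ _ _ => hfull X₂ π hπ x, fun x _ _ d hd s hs => ((hfull X₂ π hπ x).2 d hd s hs).1⟩⟩

/-! ## §2 The wild pinch × 𝔸¹ -/

/-- **FC″ AT THE MOTIVATING WILD EXAMPLE — the conjuncts of `FCUnguarded`'s conclusion for `X₁ = (wild pinch) × 𝔸¹`**
(`R̄ = k[y,u,t]/(y² + u²ty + ut²)`, `char k = 2`) at `η = 𝔭·R̄[w]` for EVERY prime `𝔭 ⊇ (ȳ, t̄)` of `R̄` — in particular at the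
generic point of `{wild pinch point} × 𝔸¹`, a bad non-closed point with NO `𝔪_η`-primary point-fix (Theorem W): `J := ((ȳ,t̄)·R̄[w])~`,
`c' := (ȳ, t̄)` in `𝒪_η` (currency (A′)), from `WildPinchClosedCentre.affineBlowup_full`. First inhabited instance of the FC″ body at a
wild point. [folklore assembly; OURS as a certificate] -/
theorem fcUnguarded_body_wildPinchCylinder (k : Type) [Field k] [CharP k 2] (f : MvPolynomial (Fin 3) k)
    (hf : f = MvPolynomial.X 0 ^ 2 + MvPolynomial.X 1 ^ 2 * MvPolynomial.X 2 * MvPolynomial.X 0 + MvPolynomial.X 1 * MvPolynomial.X 2 ^ 2)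
    (𝔭 : Spec (.of (MvPolynomial (Fin 3) k ⧸ Ideal.span {f})))
    (h𝔭 : Ideal.span {Ideal.Quotient.mk (Ideal.span {f}) (MvPolynomial.X 0), Ideal.Quotient.mk (Ideal.span {f}) (MvPolynomial.X 2)} ≤
      𝔭.asIdeal)
    (η : Spec (.of (MvPolynomial (Fin 3) k ⧸ Ideal.span {f})[X]))
    (hη : η.asIdeal = 𝔭.asIdeal.map (C : (MvPolynomial (Fin 3) k ⧸ Ideal.span {f}) →+* (MvPolynomial (Fin 3) k ⧸ Ideal.span {f})[X])) :
    ∃ (J : (Spec (.of (MvPolynomial (Fin 3) k ⧸ Ideal.span {f})[X])).IdealSheafData) (n' : ℕ)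
      (c' : Fin n' → (Spec (.of (MvPolynomial (Fin 3) k ⧸ Ideal.span {f})[X])).presheaf.stalk η),
      J ≠ ⊥ ∧ η ∈ (J.support : Set (Spec (.of (MvPolynomial (Fin 3) k ⧸ Ideal.span {f})[X]))) ∧
      Ideal.span (Set.range c') ≠ ⊥ ∧
      Ideal.span (Set.range c') ≤ maximalIdeal ((Spec (.of (MvPolynomial (Fin 3) k ⧸ Ideal.span {f})[X])).presheaf.stalk η) ∧
      (∀ (j : Fin n') (𝔔 : PrimeSpectrum (blowupAlgebra (Ideal.span (Set.range c')) (c' j))),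
        𝔔.asIdeal.comap (algebraMap ((Spec (.of (MvPolynomial (Fin 3) k ⧸ Ideal.span {f})[X])).presheaf.stalk η)
          (blowupAlgebra (Ideal.span (Set.range c')) (c' j))) =
          maximalIdeal ((Spec (.of (MvPolynomial (Fin 3) k ⧸ Ideal.span {f})[X])).presheaf.stalk η) →
        IsDomain (Localization.AtPrime 𝔔.asIdeal) ∧ ∀ d : ℕ, ringKrullDim (Localization.AtPrime 𝔔.asIdeal) = d →
          ∀ s : Fin d → Localization.AtPrime 𝔔.asIdeal, (Ideal.span (Set.range s)).radical.IsMaximal →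
            RingTheory.Sequence.IsWeaklyRegular (Localization.AtPrime 𝔔.asIdeal) (List.ofFn s) ∧
            ∀ y : Localization.AtPrime 𝔔.asIdeal, (∃ e : ℕ, y ^ 2 ^ e ∈ Ideal.span ((fun z : Localization.AtPrime 𝔔.asIdeal => z ^ 2 ^ e) ''
              (Ideal.span (Set.range s) : Set (Localization.AtPrime 𝔔.asIdeal)))) → y ∈ Ideal.span (Set.range s)) ∧
      stalkIdeal J η = Ideal.span (Set.range c') ∧
      (∀ (X₂ : Scheme.{0}) (π : X₂ ⟶ Spec (.of (MvPolynomial (Fin 3) k ⧸ Ideal.span {f})[X])), IsBlowup π J →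
        (∀ x : X₂, π.base x ∈ (J.support : Set (Spec (.of (MvPolynomial (Fin 3) k ⧸ Ideal.span {f})[X]))) → π.base x ≠ η →
          ¬ IsClosed ({x} : Set X₂) →
          IsDomain (X₂.presheaf.stalk x) ∧ ∀ d : ℕ, ringKrullDim (X₂.presheaf.stalk x) = d → ∀ s : Fin d → X₂.presheaf.stalk x,
            (Ideal.span (Set.range s)).radical.IsMaximal → RingTheory.Sequence.IsWeaklyRegular (X₂.presheaf.stalk x) (List.ofFn s) ∧
            ∀ t : X₂.presheaf.stalk x, (∃ e : ℕ, t ^ 2 ^ e ∈ Ideal.span ((fun z : X₂.presheaf.stalk x => z ^ 2 ^ e) ''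
              (Ideal.span (Set.range s) : Set (X₂.presheaf.stalk x)))) → t ∈ Ideal.span (Set.range s)) ∧
        (∀ x : X₂, π.base x ∈ (J.support : Set (Spec (.of (MvPolynomial (Fin 3) k ⧸ Ideal.span {f})[X]))) → IsClosed ({x} : Set X₂) →
          ∀ d : ℕ, ringKrullDim (X₂.presheaf.stalk x) = d → ∀ s : Fin d → X₂.presheaf.stalk x,
            (Ideal.span (Set.range s)).radical.IsMaximal → RingTheory.Sequence.IsWeaklyRegular (X₂.presheaf.stalk x) (List.ofFn s))) := by
  haveI : Fact (Nat.Prime 2) := ⟨Nat.prime_two⟩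
  haveI : IsDomain (MvPolynomial (Fin 3) k ⧸ Ideal.span {f}) := WildPinchClosedCentre.isDomain_wildPinch k f hf
  haveI : CharP (MvPolynomial (Fin 3) k ⧸ Ideal.span {f}) 2 :=
    charP_of_injective_algebraMap (algebraMap k (MvPolynomial (Fin 3) k ⧸ Ideal.span {f})).injective 2
  have hIg : Ideal.span {Ideal.Quotient.mk (Ideal.span {f}) (MvPolynomial.X 0), Ideal.Quotient.mk (Ideal.span {f}) (MvPolynomial.X 2)} =
      Ideal.span (Set.range ![Ideal.Quotient.mk (Ideal.span {f}) (MvPolynomial.X 0), Ideal.Quotient.mk (Ideal.span {f}) (MvPolynomial.X 2)]) := by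
    rw [Summit.ResolutionOfSingularities.ResolutionOfSingularities.Theorems.RadicialJung.CleanModelsSuffice.GameState.range_pair]
  have hI0 : Ideal.span {Ideal.Quotient.mk (Ideal.span {f}) (MvPolynomial.X 0), Ideal.Quotient.mk (Ideal.span {f}) (MvPolynomial.X 2)} ≠ ⊥ := by
    intro h0
    have hmem : Ideal.Quotient.mk (Ideal.span {f}) (MvPolynomial.X 0) ∈ (⊥ : Ideal (MvPolynomial (Fin 3) k ⧸ Ideal.span {f})) :=
      h0 ▸ Ideal.subset_span (Set.mem_insert _ _)
    rw [Ideal.mem_bot, Ideal.Quotient.eq_zero_iff_mem, Ideal.mem_span_singleton] at hmem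
    exact (WildPinchClosedCentre.prime_wildPinch k f hf).2 0 hmem
  exact fcUnguarded_body_cylinder_of_full 2 (MvPolynomial (Fin 3) k ⧸ Ideal.span {f}) _ _ hIg hI0
    (WildPinchClosedCentre.affineBlowup_full k f hf _ ((WildPinchClosedCentre.centre_eq_span_pair k f).symm)) 𝔭 h𝔭 η hη

end Summit.ResolutionOfSingularities.ResolutionOfSingularities.Theorems.FInjectiveMacaulayfication.FullBlowupCylinderFC
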